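import Mathlib.Data.Rat.Defs
import Mathlib.Tactic.Ring
import Mathlib.Tactic.LinearCombination
import Mathlib.Tactic.Linarith
import Mathlib.Tactic.Push
import Mathlib.Tactic.NormNum
import Mathlib.Tactic.FieldSimp
import HarnessLib

/-!
# Venture HSemireg — LEMMA 𝔭 of PROBE5 §13 (THEOREM R1-DIOPHANTINE), the INDEX COMPUTATION `(I₂ : I₁) = ½𝔭`: in coordinates,
# `x = a + b·l` multiplies the weight-1 lattice into `M′ = ℤ² ⊕ ½ℤ²` iff `a − bA, bN ∈ ℤ` and `bt, a + bA ∈ ½ℤ`, and — because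
# `gcd(N∕2, t, 2A) = 1` (Bézout) — this says exactly `x ∈ ℤ·1 + ℤ·(A + l)∕2 = ½·(2, A + l)` — kernel arithmetic

HONEST FRAMING. Lean index of the computation cell `pub-hsemireg`, widening group ENGINE-W (code A, seat `engine-w-1`, gen 18).
RATIONAL ∕ INTEGER ARITHMETIC ONLY, one `O_K`-coordinate at a time (the conditions of §13 are `O_K`-linear and `O_K ≅ ℤ²` coordinatewise, so
`a, b` range over `ℚ` here). What is NOT formalised: the lattices `I₁, I₂`, the identification `M′ = D′⁻¹ℤ⁴`, Gorenstein-ness of `R`, the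
conclusion `I₂ = ½𝔭·I₁`, `h₂ = 2h₁`, or anything object-level; nothing here says that HC, HC_CM or HC_AV holds. Theorems only (0 `def`, 0 named
fact, 0 `sorry`). New namespace `WeightTwoIndex`. Companions (the rest of §13's kernel route): `R1DiophantinePellTwo.lean` (#31: LEMMA 𝔭's gcd
step `gcd(N, t, A) = 1`, LEMMA ∥'s identity and the last step `r² − m s² = 2`), `PrimeOverTwo.lean` (#37: `𝔭² = (2)` ∕ `2𝔭`, `τ𝔭 = 𝔭`, `𝔭 = (2, A + l)`),
`ParallelLatticeVectors.lean` (#40: LEMMA ∥'s lattice step), `SecantClosedForm.lean` (#42: the block `𝒥′ = [[−A, −N F⁻¹],[tF, A]]`).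

SOURCE (the cell's own result, by value): `widen/ENGINE-W/out/probe5/PROBE5-STIZ-A.md` §13 LEMMA 𝔭, PROOF: «Write x = a + b·l (a, b ∈ K); in the basis
(d_x,d_y | x,y) the structure-1 action of x is [[a − bA, −bN·F⁻¹],[bt·F, a + bA]] (… F unimodular on a weight-1 factor). x ∈ (I₂:I₁) ⟺ x·₁ℤ⁴ ⊂ M′ ⟺
a − bA, bN ∈ O_K and bt, a + bA ∈ ½O_K. Put c := 2b: then c·(N∕2) ∈ O_K, c·t ∈ O_K and (from the first and last conditions) 2c·A ∈ O_K; gcd(N∕2, t, 2A)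
= gcd(N∕2, t, A) (N∕2 odd) = 1 … so c ∈ O_K, i.e. b ∈ ½O_K, and then a ∈ O_K + bA. Hence (I₂:I₁) = O_K·1 + O_K·(A + l)∕2 = ½·(2, A + l)_R = ½𝔭».
What the kernel holds (`a b : ℚ`; `A N′ t : ℤ`, `N = 2N′`; «`q` integral» := `∃ k : ℤ, q = k`):

* `action_entries` — `a·1 + b·𝒥′` has the four distinct entries `a − bA`, `−bN` (times the unimodular `F⁻¹`), `bt` (times `F`), `a + bA` (trivial
  bookkeeping, recorded as the polynomial identities of the diagonal∕off-diagonal blocks).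
* `index_forward` — if `a − bA`, `b·N`, `2·(b t)`, `2·(a + bA)` are integral and `u₁N′ + u₂t + u₃·(2A) = 1` (Bézout for `gcd(N′, t, 2A) = 1`),
  then `2b` is integral (explicitly `2b = u₁k₂ + u₂k₃ + u₃(k₄ − 2k₁)`) and `a − bA` is integral: `x ∈ ℤ·1 + ℤ·(A + l)∕2`.
* `index_backward` — conversely `b = v∕2`, `a = u + vA∕2` (`u, v ∈ ℤ`) satisfy the four conditions (uses only `N = 2N′`).
* `index_iff` — the equivalence, i.e. `(I₂ : I₁) = ½·(2, A + l)` coordinatewise, under the Bézout hypothesis.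
* `bezout_double` — the Bézout hypothesis from LEMMA 𝔭's own data: `g₁N′ + g₂t + g₃A = 1` (gcd(N′, t, A) = 1, #31) and `N′ = 2n + 1` odd give
  `(g₁ + g₃A)·N′ + g₂·t + (−n g₃)·(2A) = 1` (since `g₃A = g₃A·N′ − n g₃·(2A)`), i.e. `gcd(N′, t, 2A) = 1` as used above.
* `instance_sqrt7` — ℚ(√7), R1 target `(A, N) = (3, 2)` (`N′ = t = 1`): `x = (3 + l)∕2` passes the four conditions, `x = l∕2` fails the first.
-/

namespace Summit.Ventures.HSemireg.WeightTwoIndex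

/-- **Structure-1 action of `x = a + b·l`** (bookkeeping): with `𝒥′ = [[−A·I, −N·F⁻¹],[t·F, A·I]]` the matrix `a·1 + b·𝒥′` has diagonal blocks
`(a − bA)·I`, `(a + bA)·I` and off-diagonal blocks `−(bN)·F⁻¹`, `(bt)·F` — recorded as the scalar identities of the block coefficients. [kernel] -/
theorem action_entries (a b A N t : ℚ) :
    a + b * (-A) = a - b * A ∧ b * (-N) = -(b * N) ∧ b * t = b * t ∧ a + b * A = a + b * A := by
  refine ⟨by ring, by ring, rfl, rfl⟩

/-- **`index_forward` (the Bézout step of LEMMA 𝔭)**: if `a − bA = k₁`, `b·(2N′) = k₂`, `2bt = k₃`, `2(a + bA) = k₄` are integers and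
`u₁N′ + u₂t + u₃(2A) = 1`, then `2b = u₁k₂ + u₂k₃ + u₃(k₄ − 2k₁)` is an integer (and `a − bA = k₁` is). [kernel, `linear_combination`] -/
theorem index_forward (a b : ℚ) (A N' t k₁ k₂ k₃ k₄ u₁ u₂ u₃ : ℤ)
    (h₁ : a - b * A = k₁) (h₂ : b * (2 * N') = k₂) (h₃ : 2 * (b * t) = k₃) (h₄ : 2 * (a + b * A) = k₄)
    (hbez : u₁ * N' + u₂ * t + u₃ * (2 * A) = 1) :
    2 * b = ((u₁ * k₂ + u₂ * k₃ + u₃ * (k₄ - 2 * k₁) : ℤ) : ℚ) := by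
  have hbq : (u₁ : ℚ) * N' + u₂ * t + u₃ * (2 * A) = 1 := by exact_mod_cast hbez
  push_cast
  linear_combination (-2 * b) * hbq + (u₁ : ℚ) * h₂ + (u₂ : ℚ) * h₃ + (u₃ : ℚ) * h₄ - 2 * (u₃ : ℚ) * h₁

/-- Hence, under the hypotheses of `index_forward`, `x = a + b·l` lies in `ℤ·1 + ℤ·(A + l)∕2`: `b = v∕2` and `a = u + v·A∕2` with
`v = u₁k₂ + u₂k₃ + u₃(k₄ − 2k₁)`, `u = k₁`. [kernel] -/
theorem index_forward_membership (a b : ℚ) (A N' t k₁ k₂ k₃ k₄ u₁ u₂ u₃ : ℤ)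
    (h₁ : a - b * A = k₁) (h₂ : b * (2 * N') = k₂) (h₃ : 2 * (b * t) = k₃) (h₄ : 2 * (a + b * A) = k₄)
    (hbez : u₁ * N' + u₂ * t + u₃ * (2 * A) = 1) :
    ∃ u v : ℤ, b = (v : ℚ) / 2 ∧ a = u + (v : ℚ) * A / 2 := by
  refine ⟨k₁, u₁ * k₂ + u₂ * k₃ + u₃ * (k₄ - 2 * k₁), ?_, ?_⟩
  · have h := index_forward a b A N' t k₁ k₂ k₃ k₄ u₁ u₂ u₃ h₁ h₂ h₃ h₄ hbez
    linarith
  · have h := index_forward a b A N' t k₁ k₂ k₃ k₄ u₁ u₂ u₃ h₁ h₂ h₃ h₄ hbez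
    have hb : b = ((u₁ * k₂ + u₂ * k₃ + u₃ * (k₄ - 2 * k₁) : ℤ) : ℚ) / 2 := by linarith
    rw [hb] at h₁
    linarith

/-- **`index_backward`**: every `x = u + v·(A + l)∕2` (`u, v ∈ ℤ`), i.e. `a = u + vA∕2`, `b = v∕2`, satisfies the four conditions:
`a − bA = u`, `b·(2N′) = vN′`, `2bt = vt`, `2(a + bA) = 2u + 2vA` — all integers. [kernel] -/
theorem index_backward (u v A N' t : ℤ) :
    let a : ℚ := u + (v : ℚ) * A / 2
    let b : ℚ := (v : ℚ) / 2
    a - b * A = (u : ℤ) ∧ b * (2 * N') = ((v * N' : ℤ) : ℚ) ∧ 2 * (b * t) = ((v * t : ℤ) : ℚ) ∧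
      2 * (a + b * A) = ((2 * u + 2 * v * A : ℤ) : ℚ) := by
  refine ⟨by ring, by push_cast; ring, by push_cast; ring, by push_cast; ring⟩

/-- **LEMMA 𝔭, index form: `(I₂ : I₁) = ½·(2, A + l)` coordinatewise.** Under Bézout `u₁N′ + u₂t + u₃(2A) = 1`:
`(a − bA, 2bN′, 2bt, 2(a + bA) all integral) ⟺ ∃ u v ∈ ℤ, b = v∕2 ∧ a = u + vA∕2`. [kernel] -/
theorem index_iff (a b : ℚ) (A N' t u₁ u₂ u₃ : ℤ) (hbez : u₁ * N' + u₂ * t + u₃ * (2 * A) = 1) :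
    ((∃ k₁ : ℤ, a - b * A = k₁) ∧ (∃ k₂ : ℤ, b * (2 * N') = k₂) ∧ (∃ k₃ : ℤ, 2 * (b * t) = k₃) ∧ (∃ k₄ : ℤ, 2 * (a + b * A) = k₄))
      ↔ ∃ u v : ℤ, b = (v : ℚ) / 2 ∧ a = u + (v : ℚ) * A / 2 := by
  constructor
  · rintro ⟨⟨k₁, h₁⟩, ⟨k₂, h₂⟩, ⟨k₃, h₃⟩, ⟨k₄, h₄⟩⟩
    exact index_forward_membership a b A N' t k₁ k₂ k₃ k₄ u₁ u₂ u₃ h₁ h₂ h₃ h₄ hbez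
  · rintro ⟨u, v, hb, ha⟩
    obtain ⟨e₁, e₂, e₃, e₄⟩ := index_backward u v A N' t
    subst hb; subst ha
    exact ⟨⟨u, e₁⟩, ⟨v * N', e₂⟩, ⟨v * t, e₃⟩, ⟨2 * u + 2 * v * A, e₄⟩⟩

/-- **The Bézout hypothesis from LEMMA 𝔭's data**: `g₁N′ + g₂t + g₃A = 1` and `N′ = 2n + 1` ⟹ `(g₁ + g₃A)N′ + g₂t + (−n g₃)(2A) = 1`
(because `A = A·N′ − n·(2A)`), so `gcd(N′, t, 2A) = 1` in Bézout form. [kernel, `linear_combination`] -/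
theorem bezout_double (N' t A g₁ g₂ g₃ n : ℤ) (hg : g₁ * N' + g₂ * t + g₃ * A = 1) (hodd : N' = 2 * n + 1) :
    ∃ u₁ u₂ u₃ : ℤ, u₁ * N' + u₂ * t + u₃ * (2 * A) = 1 :=
  ⟨g₁ + g₃ * A, g₂, -(n * g₃), by linear_combination hg + (g₃ * A) * hodd⟩

/-- **Worked instance** (ℚ(√7), the R1 target `(A, N) = (3, 2)`: `N′ = 1`, `t = (9 − 7)∕2 = 1`): Bézout `1·N′ + 0·t + 0·(2A) = 1`, and e.g.
`x = (3 + l)∕2` (`a = 3∕2`, `b = 1∕2`) passes the four conditions (`a − bA = 0`, `2bN′ = 1`, `2bt = 1`, `2(a + bA) = 6`) while `x = l∕2`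
(`a = 0`, `b = 1∕2`) fails the first (`a − bA = −3∕2 ∉ ℤ`). [kernel, `norm_num`] -/
theorem instance_sqrt7 :
    ((3 : ℚ) / 2 - 1 / 2 * 3 = (0 : ℤ) ∧ (1 : ℚ) / 2 * (2 * 1) = (1 : ℤ) ∧ 2 * ((1 : ℚ) / 2 * 1) = (1 : ℤ) ∧
      2 * ((3 : ℚ) / 2 + 1 / 2 * 3) = (6 : ℤ)) ∧ ¬ ∃ k : ℤ, (0 : ℚ) - 1 / 2 * 3 = k := by
  refine ⟨⟨by norm_num, by norm_num, by norm_num, by norm_num⟩, ?_⟩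
  rintro ⟨k, hk⟩
  have h2 : (2 : ℚ) * k = -3 := by linarith
  have h2' : (2 * k : ℤ) = -3 := by exact_mod_cast h2
  omega

end Summit.Ventures.HSemireg.WeightTwoIndex
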